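import Literature.MathematicalPhysics.QuantumFieldTheory.Balaban1983to89.B2Eq350CorridorCover
import Literature.MathematicalPhysics.QuantumFieldTheory.Balaban1983to89.B2Ineq342From346

/-!
# `Balaban1983to89.B2Ineq352CorridorBound` — [Balaban1982Higgs2] Sect. 3.C p. 594 **(3.51)–(3.52)** for the lattice
# corridor construction of `B2Eq350CorridorCover`: the evolved cube sides are `O(1)·r(Lᵏε)`, hence
# `|Λ₀⁽ᵏ⁾ᶜ|, |Λ₇⁽ᵏ⁾ᶜ|, |Λ₅⁽ᵏ⁾ᶜ| ≤ O(1) r(Lᵏε)ᵈ (|𝒞₀| + … + |𝒞_k|)` — the leaf `B2Sect3C.Bound352` and the collar bounds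
# DERIVED from the cover properties of the construction, and (3.42) END TO END for one run

statement-level skeleton of published theorems with citation tags; proofs where landed; nothing here is a claim about the Yang–Mills mass gap

PDF held: `paper:balaban1982-cmp86-higgs23-ii` (T. Bałaban, *(Higgs)₂,₃ quantum fields in a finite volume. II. An upper
bound*, Commun. Math. Phys. **86** (1982) 555–594 [Balaban1982Higgs2]; journal page = PDF page + 554); pp. 593–594
[PDF 39–40] READ AS IMAGES on `run/shared/lean/pub/pub-balaban/b2b-balaban-ref1/pages/1982-cmp86-higgs23-II/
1982-cmp86-higgs23-II-p039-x2.png`, `…-p040-x2.png`.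

CITATION HEADER (lean-in-tree rule).  Cell `lit-balaban` (HOME `run/shared/lean/pub/lit-balaban/`), Phase-2 proof seat
**p23** gen 8 (unit `lit-balaban-p23-g8`); SKELETON rows **B2.Eq3.47** (members (3.48)–(3.52); leaves
`B2Sect3C.Bound350`/`Bound352`) and **B2.Eq3.42** ((3.42), `B2.Ineq342With`); fold owner r02, second reader r14, referee
ref-4.  Sibling of `B2Eq350CorridorCover` (same seat: `box`, `blk`, `cubes`, `evolve`, `sideB`, `cover`, `card_le_cover`,
`card_collar_le_cover`), consumer of this seat's `B2Ineq342From346.ineq342_of_346` and `B2Ineq347SeqCount.entropy_of_blocks`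
(p269421, p268178) and of `B2Sect3C` (`r_rescale_le`, `term351`, `S351`, `sum_le_S351`, `one_le_xk`, `Bound352`), all BY
NAME.  Nothing of another seat is restated; no definition is introduced (theorems only).

WHAT IS PRINTED (p. 594 [PDF 40], verbatim).  *"The expression on the right sides of the above inequalities can be
simplified. Thus  r(Lᵏ⁻ʲε) ≤ (1 + j log L)ʳ r(Lᵏε) and the factor standing at |𝒞_l| can be estimated by
(22r(Lᵏε))ᵈ(L^{−(k−1)}(1 + (k−1) log L)ʳ + … + L⁻¹(1 + log L)ʳ + 1) ≤ 22ᵈ Σ_{j=0}^∞ L⁻ʲ(1 + j log L)ʳ (r(Lᵏε))ᵈ =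
O(1)(r(Lᵏε))ᵈ,  (3.51)  hence  |Λ₀⁽ᵏ⁾ᶜ| ≤ O(1) r(Lᵏε)ᵈ(|𝒞₀| + … + |𝒞_k|).  (3.52)"*

WHAT IS KERNEL-CHECKED (zero `sorry`; axioms standard).
 §1 `geom_sum_inv_le_two` (`Σ_{i<n} L⁻ⁱ ≤ 2`, L ≥ 2); **`sideB_le_sum`** (the exact lattice sides of the corridor
    construction unrolled: `sideB(l, j) ≤ s_l L⁻ʲ + Σ_{i<j} L^{−(j−1−i)}(2t_{l+i}/L + 2)`);
    **`sideB_le_r`** — (3.51) for the lattice construction: with cube sides `s_k ≤ σ r(Lᵏε)` (print: σ = 2) and corridor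
    half-thickness `t_k ≤ τ r(Lᵏε)` (print: τ = 10), `sideB(l, k − l) ≤ ((σ + 2τ)·S351 + 4)·r(Lᵏε)` for `l ≤ k < K`
    (`S351 = Σ_j L⁻ʲ(1 + j log L)ʳ`, the printed O(1); the `+4` is the lattice rounding; uses `r(Lᵏ⁻ʲε) ≤ (1 + j log L)ʳ
    r(Lᵏε)` = `B2Sect3C.r_rescale_le`, `R ≥ 1`, `L ≥ 2`, `Lᴷε ≤ 1`).
 §2 **`bound352_of_cover : … → B2Sect3C.Bound352 P ρ X (((σ + 2τ)S351 + 4)ᵈ)`** — the leaf (3.52) DERIVED for every run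
    whose combinatorial data come from lattice corridor data satisfying the two cover properties (per admissible sequence:
    `Λ₀⁽⁰⁾ᶜ ⊂ ∪𝒞₀`; new part of `Λ₀⁽ᵏ⁺¹⁾ᶜ` in `∪𝒞_{k+1}`, old part = blocked image of the `t_k`-collar of `Λ₀⁽ᵏ⁾ᶜ`), and
    **`collar_of_cover`** — the (3.52)-SHAPE bound for any collar set (`|V| ≤ ((σ+2τ)S351 + 4 + 2τ′)ᵈ r(Lᵏε)ᵈ Σ_{j≤k}|𝒞_j|`
    when every point of `V` is within `t′_k ≤ τ′ r(Lᵏε)` of `Λ₀⁽ᵏ⁾ᶜ`) = the hypotheses `h7`/`h5` of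
    `B2Ineq342From346.ineq342_of_346` for `|Λ₇⁽ᵏ⁻¹⁾′∩Λ₇⁽ᵏ⁾ᶜ| ≤ |Λ₇⁽ᵏ⁾ᶜ|`, `|Λ₅⁽ᵏ⁻¹⁾′∩Λ₅⁽ᵏ⁾ᶜ| ≤ |Λ₅⁽ᵏ⁾ᶜ|`.
 §3 **`ineq342_of_cover`** — (3.42) `B2.Ineq342With P ρ (C₇ + C₅ + 1/m)` for ONE run, END TO END from: the (3.46) shape,
    the lattice corridor data with its two cover properties and printed-shape size bounds, collar sets for the Λ₇/Λ₅
    volumes, the large-block structure of the sequences (`entropy_of_blocks`), the k = K volumes, and the per-scale (3.54)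
    condition — the whole of Sect. 3.C with NO typed leaf left (`Leaf347`, `Bound350`, `Bound352` all bypassed/derived).

HONEST SCOPE.  (a) The O(1) of (3.52) here is `((σ+2τ)S351 + 4)ᵈ` (print, read literally: `(22·S351)ᵈ`, cf.
`B2Sect3C.bound352_of_350`; the `+4` is lattice rounding); the literal (3.50) coefficients are not claimed.  (b) The
inputs that remain HYPOTHESES in `ineq342_of_cover` are: the (3.46) shape (r14's `B2Eq341Zeta.zeta341_le` gives it for
every admissible-tuple dictionary), the cover/size properties DEFINING `𝒞_k`, `Λ_i⁽ᵏ⁾` ((3.43)/(3.45), (2.7)–(2.8),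
p. 566) for a concrete multi-scale region model (not in the tree), the block injection of the sequences, and the
constants' conditions (`R ≥ 1`, `t ≤ τr` i.e. `7(r + ML) ≤ τ r`, the per-scale (3.54) condition supplied by
`B2.coeff354_threshold`).  (c) Value = Sect. 3.C of [Balaban1982Higgs2] reduced in the kernel to its model's defining
properties; NOT summit progress.
-/

namespace Literature.MathematicalPhysics.QuantumFieldTheory.Balaban1983to89.B2Ineq352CorridorBound

open Finset
open Literature.MathematicalPhysics.QuantumFieldTheory.Balaban1983to89
open Literature.MathematicalPhysics.QuantumFieldTheory.Balaban1983to89.B2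
open Literature.MathematicalPhysics.QuantumFieldTheory.Balaban1983to89.B2Sect3C
open Literature.MathematicalPhysics.QuantumFieldTheory.Balaban1983to89.B2Eq350CorridorCover

/-! ## §1. (3.51): the evolved sides are `O(1)·r(Lᵏε)` -/

/-- `Σ_{i<n} L⁻ⁱ ≤ 2` for `L ≥ 2`. [folklore] -/
private theorem geom_sum_inv_le_two {L : ℝ} (hL : 2 ≤ L) (n : ℕ) : ∑ i ∈ range n, (L⁻¹) ^ i ≤ 2 := by
  have hL0 : 0 < L := by linarith
  have hinv : L⁻¹ ≤ 1 / 2 := by rw [inv_eq_one_div]; exact one_div_le_one_div_of_le (by norm_num) hL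
  have hinv0 : 0 ≤ L⁻¹ := inv_nonneg.mpr hL0.le
  induction n with
  | zero => simp
  | succ n ih =>
    rw [Finset.sum_range_succ', pow_zero]
    have hs : ∑ i ∈ range n, (L⁻¹) ^ (i + 1) = L⁻¹ * ∑ i ∈ range n, (L⁻¹) ^ i := by
      rw [Finset.mul_sum]
      exact Finset.sum_congr rfl fun i _ => by ring
    rw [hs]
    have h0 : 0 ≤ ∑ i ∈ range n, (L⁻¹) ^ i := Finset.sum_nonneg fun i _ => pow_nonneg hinv0 _
    nlinarith

/-- The exact lattice sides UNROLLED: `sideB(l, j) ≤ s_l L⁻ʲ + Σ_{i<j} L^{−(j−1−i)}·(2t_{l+i}/L + 2)` (the print's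
`L⁻ʲ·side + Σ L^{−(j−i)}·20r` with the rounding terms `+2`). [cite: Balaban1982Higgs2, (3.50)–(3.51) pp.593–594] -/
theorem sideB_le_sum {L : ℕ} (hL : 0 < L) (t s : ℕ → ℕ) (l : ℕ) : ∀ j,
    (sideB L t s l j : ℝ) ≤ (s l : ℝ) * ((L : ℝ)⁻¹) ^ j
      + ∑ i ∈ range j, ((L : ℝ)⁻¹) ^ (j - 1 - i) * (2 * (t (l + i) : ℝ) / L + 2)
  | 0 => by simp [sideB]
  | j + 1 => by
    have ih := sideB_le_sum hL t s l j
    have hL0 : (0 : ℝ) < L := by exact_mod_cast hL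
    have hdiv : ((sideB L t s l (j + 1) : ℕ) : ℝ)
        ≤ ((sideB L t s l j : ℝ) + 2 * (t (l + j) : ℝ)) / L + 2 := by
      show (((sideB L t s l j + 2 * t (l + j)) / L + 2 : ℕ) : ℝ) ≤ _
      have h := Nat.cast_div_le (α := ℝ) (m := sideB L t s l j + 2 * t (l + j)) (n := L)
      push_cast at h ⊢
      linarith
    refine le_trans hdiv ?_
    have hkey : ∑ i ∈ range (j + 1), ((L : ℝ)⁻¹) ^ (j + 1 - 1 - i) * (2 * (t (l + i) : ℝ) / L + 2)
        = (∑ i ∈ range j, ((L : ℝ)⁻¹) ^ (j - 1 - i) * (2 * (t (l + i) : ℝ) / L + 2)) * (L : ℝ)⁻¹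
          + (2 * (t (l + j) : ℝ) / L + 2) := by
      rw [Nat.add_sub_cancel, Finset.sum_range_succ, Nat.sub_self, pow_zero, one_mul, Finset.sum_mul]
      congr 1
      refine Finset.sum_congr rfl fun i hi => ?_
      have hi' := Finset.mem_range.mp hi
      rw [show j - i = (j - 1 - i) + 1 by omega, pow_succ]
      ring
    rw [hkey]
    have hmono : ((sideB L t s l j : ℝ) + 2 * (t (l + j) : ℝ)) / L + 2
        ≤ ((s l : ℝ) * ((L : ℝ)⁻¹) ^ j
            + ∑ i ∈ range j, ((L : ℝ)⁻¹) ^ (j - 1 - i) * (2 * (t (l + i) : ℝ) / L + 2)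
            + 2 * (t (l + j) : ℝ)) / L + 2 := by
      gcongr
    refine le_trans hmono (le_of_eq ?_)
    rw [pow_succ]
    ring

/-- **(3.51) for the lattice construction**: if the cubes of `𝒞_k` have sides `≤ σ·r(Lᵏε)` (print: `< 2r(Lᵏε)`) and the
corridor half-thickness is `≤ τ·r(Lᵏε)` (print: thickness `< 10r`), then for `l ≤ k < K` the evolved side satisfies
`sideB(l, k−l) ≤ ((σ + 2τ)·S351 + 4)·r(Lᵏε)`, `S351 = Σ_j L⁻ʲ(1 + j log L)ʳ` — via *"r(Lᵏ⁻ʲε) ≤ (1 + j log L)ʳ r(Lᵏε)"*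
(`B2Sect3C.r_rescale_le`), `Σ_j L⁻ʲ(1 + j log L)ʳ ≤ S351` (`B2Sect3C.sum_le_S351`), `R ≥ 1` (so `r(Lᵏε) ≥ 1` absorbs the
rounding `+4`), `L ≥ 2`, `Lᴷε ≤ 1`. [cite: Balaban1982Higgs2, (3.51) p.594] -/
theorem sideB_le_r (P : Params) (ρ : Run) {σ τ : ℝ} (hL2 : 2 ≤ (P.L : ℝ)) (hR : 1 ≤ P.R) (hr : 0 ≤ P.r)
    (hε : 0 < ρ.ε) (hK1 : epsK P ρ ρ.K ≤ 1) (hσ : 0 ≤ σ) (hτ : 0 ≤ τ) (t s : ℕ → ℕ)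
    (hs : ∀ k, k < ρ.K → (s k : ℝ) ≤ σ * rFn P.R P.r (epsK P ρ k))
    (ht : ∀ k, k < ρ.K → (t k : ℝ) ≤ τ * rFn P.R P.r (epsK P ρ k))
    {l k : ℕ} (hlk : l ≤ k) (hk : k < ρ.K) :
    (sideB P.L t s l (k - l) : ℝ) ≤ ((σ + 2 * τ) * S351 (P.L : ℝ) P.r + 4) * rFn P.R P.r (epsK P ρ k) := by
  have hL1 : 1 < (P.L : ℝ) := by linarith
  have hLpos : 0 < P.L := by exact_mod_cast (show (0 : ℝ) < P.L by linarith)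
  have hLr0 : (0 : ℝ) < P.L := by exact_mod_cast hLpos
  set n := k - l with hn
  set rk : ℕ → ℝ := fun m => rFn P.R P.r (epsK P ρ m) with hrk
  -- r(Lᵏε) ≥ 1
  have hx1 : 1 ≤ xk P ρ k := one_le_xk P ρ hL1.le hε hK1 hk.le
  have hrk1 : 1 ≤ rk k := by
    show 1 ≤ rFn P.R P.r (epsK P ρ k)
    rw [rFn_epsK]
    have := Real.one_le_rpow hx1 hr
    nlinarith
  have hrk0 : 0 ≤ rk k := le_trans zero_le_one hrk1
  have hLinv0 : 0 ≤ ((P.L : ℝ)⁻¹) := inv_nonneg.mpr hLr0.le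
  -- the rescaling inequality r(L^{k-j}ε) ≤ term-free form
  have hresc : ∀ j, j ≤ n → rk (k - j) * ((P.L : ℝ)⁻¹) ^ j ≤ term351 (P.L : ℝ) P.r j * rk k := by
    intro j hj
    have h := r_rescale_le P ρ hL1.le (le_trans zero_le_one hR) hr hε hK1 (show j ≤ k by omega) hk.le
    show rFn P.R P.r (epsK P ρ (k - j)) * ((P.L : ℝ)⁻¹) ^ j ≤ term351 (P.L : ℝ) P.r j * rFn P.R P.r (epsK P ρ k)
    unfold term351
    have hp : 0 ≤ ((P.L : ℝ)⁻¹) ^ j := pow_nonneg hLinv0 _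
    calc rFn P.R P.r (epsK P ρ (k - j)) * ((P.L : ℝ)⁻¹) ^ j
        ≤ ((1 + j * Real.log (P.L : ℝ)) ^ P.r * rFn P.R P.r (epsK P ρ k)) * ((P.L : ℝ)⁻¹) ^ j :=
          mul_le_mul_of_nonneg_right h hp
      _ = ((P.L : ℝ)⁻¹) ^ j * (1 + j * Real.log (P.L : ℝ)) ^ P.r * rFn P.R P.r (epsK P ρ k) := by ring
  -- Term 1: s_l L^{-n} ≤ σ S351 r_k
  have hT1 : (s l : ℝ) * ((P.L : ℝ)⁻¹) ^ n ≤ σ * S351 (P.L : ℝ) P.r * rk k := by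
    have h1 : (s l : ℝ) ≤ σ * rk l := hs l (by omega)
    have h2 : rk l * ((P.L : ℝ)⁻¹) ^ n ≤ term351 (P.L : ℝ) P.r n * rk k := by
      have := hresc n le_rfl
      rwa [show k - n = l by omega] at this
    have h3 : term351 (P.L : ℝ) P.r n ≤ S351 (P.L : ℝ) P.r := by
      have := sum_le_S351 (r := P.r) hL1 {n}
      simpa using this
    have hp : 0 ≤ ((P.L : ℝ)⁻¹) ^ n := pow_nonneg hLinv0 _
    calc (s l : ℝ) * ((P.L : ℝ)⁻¹) ^ n ≤ σ * rk l * ((P.L : ℝ)⁻¹) ^ n := mul_le_mul_of_nonneg_right h1 hp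
      _ = σ * (rk l * ((P.L : ℝ)⁻¹) ^ n) := by ring
      _ ≤ σ * (term351 (P.L : ℝ) P.r n * rk k) := mul_le_mul_of_nonneg_left h2 hσ
      _ ≤ σ * (S351 (P.L : ℝ) P.r * rk k) :=
          mul_le_mul_of_nonneg_left (mul_le_mul_of_nonneg_right h3 hrk0) hσ
      _ = σ * S351 (P.L : ℝ) P.r * rk k := by ring
  -- Term 2 + Term 3, termwise: L^{-(n-1-i)} (2t_{l+i}/L + 2) ≤ 2τ r_k term351(n-i) + 2 L^{-(n-1-i)}
  have hT23 : ∀ i ∈ range n, ((P.L : ℝ)⁻¹) ^ (n - 1 - i) * (2 * (t (l + i) : ℝ) / P.L + 2)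
      ≤ 2 * τ * rk k * term351 (P.L : ℝ) P.r (n - i) + 2 * ((P.L : ℝ)⁻¹) ^ (n - 1 - i) := by
    intro i hi
    have hi' := Finset.mem_range.mp hi
    have hti : (t (l + i) : ℝ) ≤ τ * rk (l + i) := ht (l + i) (by omega)
    have hpow : ((P.L : ℝ)⁻¹) ^ (n - 1 - i) / P.L = ((P.L : ℝ)⁻¹) ^ (n - i) := by
      rw [show n - i = (n - 1 - i) + 1 by omega, pow_succ, div_eq_mul_inv]
    have h2 : rk (l + i) * ((P.L : ℝ)⁻¹) ^ (n - i) ≤ term351 (P.L : ℝ) P.r (n - i) * rk k := by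
      have := hresc (n - i) (by omega)
      rwa [show k - (n - i) = l + i by omega] at this
    have hp : 0 ≤ ((P.L : ℝ)⁻¹) ^ (n - i) := pow_nonneg hLinv0 _
    calc ((P.L : ℝ)⁻¹) ^ (n - 1 - i) * (2 * (t (l + i) : ℝ) / P.L + 2)
        = 2 * (t (l + i) : ℝ) * (((P.L : ℝ)⁻¹) ^ (n - 1 - i) / P.L) + 2 * ((P.L : ℝ)⁻¹) ^ (n - 1 - i) := by ring
      _ = 2 * (t (l + i) : ℝ) * ((P.L : ℝ)⁻¹) ^ (n - i) + 2 * ((P.L : ℝ)⁻¹) ^ (n - 1 - i) := by rw [hpow]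
      _ ≤ 2 * (τ * rk (l + i)) * ((P.L : ℝ)⁻¹) ^ (n - i) + 2 * ((P.L : ℝ)⁻¹) ^ (n - 1 - i) := by
          gcongr
      _ = 2 * τ * (rk (l + i) * ((P.L : ℝ)⁻¹) ^ (n - i)) + 2 * ((P.L : ℝ)⁻¹) ^ (n - 1 - i) := by ring
      _ ≤ 2 * τ * (term351 (P.L : ℝ) P.r (n - i) * rk k) + 2 * ((P.L : ℝ)⁻¹) ^ (n - 1 - i) := by
          gcongr
      _ = 2 * τ * rk k * term351 (P.L : ℝ) P.r (n - i) + 2 * ((P.L : ℝ)⁻¹) ^ (n - 1 - i) := by ring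
  -- the reindexed sums
  have hS1 : ∑ i ∈ range n, term351 (P.L : ℝ) P.r (n - i) ≤ S351 (P.L : ℝ) P.r := by
    have e1 : ∑ i ∈ range n, term351 (P.L : ℝ) P.r (n - i) = ∑ i ∈ range n, term351 (P.L : ℝ) P.r (i + 1) := by
      rw [← Finset.sum_range_reflect (fun i => term351 (P.L : ℝ) P.r (i + 1)) n]
      refine Finset.sum_congr rfl fun i hi => ?_
      have hi' := Finset.mem_range.mp hi
      congr 1
      omega
    rw [e1]
    have e2 : ∑ i ∈ range (n + 1), term351 (P.L : ℝ) P.r i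
        = ∑ i ∈ range n, term351 (P.L : ℝ) P.r (i + 1) + term351 (P.L : ℝ) P.r 0 := Finset.sum_range_succ' _ n
    have h0 : 0 ≤ term351 (P.L : ℝ) P.r 0 := term351_nonneg hL1 0
    have h3 := sum_le_S351 (r := P.r) hL1 (range (n + 1))
    linarith
  have hS2 : ∑ i ∈ range n, ((P.L : ℝ)⁻¹) ^ (n - 1 - i) ≤ 2 := by
    rw [Finset.sum_range_reflect (fun i => ((P.L : ℝ)⁻¹) ^ i) n]
    exact geom_sum_inv_le_two hL2 n
  have hS0 : 0 ≤ S351 (P.L : ℝ) P.r := le_trans zero_le_one (one_le_S351 (r := P.r) hL1)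
  -- assemble
  have hsum := sideB_le_sum hLpos t s l n
  calc (sideB P.L t s l n : ℝ)
      ≤ (s l : ℝ) * ((P.L : ℝ)⁻¹) ^ n
          + ∑ i ∈ range n, ((P.L : ℝ)⁻¹) ^ (n - 1 - i) * (2 * (t (l + i) : ℝ) / P.L + 2) := hsum
    _ ≤ σ * S351 (P.L : ℝ) P.r * rk k
          + ∑ i ∈ range n, (2 * τ * rk k * term351 (P.L : ℝ) P.r (n - i) + 2 * ((P.L : ℝ)⁻¹) ^ (n - 1 - i)) :=
        add_le_add hT1 (Finset.sum_le_sum hT23)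
    _ = σ * S351 (P.L : ℝ) P.r * rk k + (2 * τ * rk k * ∑ i ∈ range n, term351 (P.L : ℝ) P.r (n - i)
          + 2 * ∑ i ∈ range n, ((P.L : ℝ)⁻¹) ^ (n - 1 - i)) := by
        rw [Finset.sum_add_distrib, Finset.mul_sum, Finset.mul_sum]
    _ ≤ σ * S351 (P.L : ℝ) P.r * rk k + (2 * τ * rk k * S351 (P.L : ℝ) P.r + 2 * 2) := by
        gcongr
    _ ≤ ((σ + 2 * τ) * S351 (P.L : ℝ) P.r + 4) * rk k := by nlinarith

/-! ## §2. (3.52) = `B2Sect3C.Bound352` and the collar bounds, DERIVED from the cover properties -/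

/-- **(3.52) DERIVED — `B2Sect3C.Bound352 P ρ X (((σ+2τ)S351 + 4)ᵈ)`** for every run whose data come, admissible
sequence by admissible sequence, from lattice corridor data (`B2Eq350CorridorCover`): `W q k = Λ₀⁽ᵏ⁾ᶜ` (|·| ≥ `vol0c`),
`C q k = 𝒞_k` (#· ≤ `nC`), cubes of `𝒞_k` of side `≤ s_k ≤ σr(Lᵏε)`, corridor half-thickness `t_k ≤ τr(Lᵏε)`, with the
two COVER properties (`Λ₀⁽⁰⁾ᶜ ⊂ ∪𝒞₀`; every point of `Λ₀⁽ᵏ⁺¹⁾ᶜ` in `∪𝒞_{k+1}` or the rescaled image of a point within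
`t_k` of `Λ₀⁽ᵏ⁾ᶜ`). [cite: Balaban1982Higgs2, (3.52) p.594] -/
theorem bound352_of_cover (P : Params) (ρ : Run) (X : CData ρ) {σ τ : ℝ}
    (hL2 : 2 ≤ (P.L : ℝ)) (hR : 1 ≤ P.R) (hr : 0 ≤ P.r) (hε : 0 < ρ.ε) (hK1 : epsK P ρ ρ.K ≤ 1)
    (hσ : 0 ≤ σ) (hτ : 0 ≤ τ)
    (W : ρ.Seq → ℕ → Finset (Fin P.d → ℤ)) (C : ρ.Seq → ℕ → Finset ((Fin P.d → ℤ) × ℕ))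
    (t s : ρ.Seq → ℕ → ℕ)
    (h0 : ∀ q, W q 0 ⊆ cubes (C q 0))
    (hnew : ∀ q k, ∀ y ∈ W q (k + 1), y ∈ cubes (C q (k + 1)) ∨
      ∃ x ∈ W q k, ∃ z : Fin P.d → ℤ, (∀ i, z i - x i ≤ t q k ∧ x i - z i ≤ t q k) ∧ blk P.L z = y)
    (hside : ∀ q k, ∀ c ∈ C q k, c.2 ≤ s q k)
    (hs : ∀ q k, k < ρ.K → (s q k : ℝ) ≤ σ * rFn P.R P.r (epsK P ρ k))
    (ht : ∀ q k, k < ρ.K → (t q k : ℝ) ≤ τ * rFn P.R P.r (epsK P ρ k))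
    (hW : ∀ q k, k < ρ.K → X.vol0c k q ≤ (W q k).card)
    (hC : ∀ q k, k < ρ.K → (C q k).card ≤ X.nC k q) :
    Bound352 P ρ X (((σ + 2 * τ) * S351 (P.L : ℝ) P.r + 4) ^ P.d) := by
  intro q k hk
  have hLpos : 0 < P.L := by exact_mod_cast (show (0 : ℝ) < P.L by linarith)
  set A : ℝ := (σ + 2 * τ) * S351 (P.L : ℝ) P.r + 4 with hA
  set rk : ℝ := rFn P.R P.r (epsK P ρ k) with hrk
  have hcount := card_le_cover hLpos (t q) (s q) (W q) (C q) (h0 q) (hnew q) (hside q) k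
  have hside_r : ∀ l ∈ range (k + 1), (sideB P.L (t q) (s q) l (k - l) : ℝ) ≤ A * rk := fun l hl =>
    sideB_le_r P ρ hL2 hR hr hε hK1 hσ hτ (t q) (s q) (hs q) (ht q)
      (Nat.lt_succ_iff.mp (Finset.mem_range.mp hl)) hk
  have hArk : 0 ≤ A * rk := le_trans (Nat.cast_nonneg _) (hside_r 0 (by simp))
  calc (X.vol0c k q : ℝ) ≤ ((W q k).card : ℝ) := by exact_mod_cast hW q k hk
    _ ≤ ∑ l ∈ range (k + 1), ((C q l).card : ℝ) * (sideB P.L (t q) (s q) l (k - l) : ℝ) ^ P.d := by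
        exact_mod_cast hcount
    _ ≤ ∑ l ∈ range (k + 1), (X.nC l q : ℝ) * (A * rk) ^ P.d := by
        refine Finset.sum_le_sum fun l hl => ?_
        have h1 : ((C q l).card : ℝ) ≤ (X.nC l q : ℝ) := by
          exact_mod_cast hC q l (lt_of_le_of_lt (Nat.lt_succ_iff.mp (Finset.mem_range.mp hl)) hk)
        have h2 : (sideB P.L (t q) (s q) l (k - l) : ℝ) ^ P.d ≤ (A * rk) ^ P.d :=
          pow_le_pow_left₀ (Nat.cast_nonneg _) (hside_r l hl) _
        exact mul_le_mul h1 h2 (pow_nonneg (Nat.cast_nonneg _) _) (Nat.cast_nonneg _)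
    _ = A ^ P.d * rk ^ P.d * ∑ l ∈ range (k + 1), (X.nC l q : ℝ) := by
        rw [Finset.mul_sum]
        exact Finset.sum_congr rfl fun l _ => by rw [mul_pow]; ring

/-- **The collar bounds in the (3.52) shape** (cell GAPS G-pv04-3 (ii); the inputs `h7`/`h5` of
`B2Ineq342From346.ineq342_of_346`): with the same corridor data, any sets `V q k` all of whose points lie within
sup-distance `t′_k ≤ τ′ r(Lᵏε)` of `Λ₀⁽ᵏ⁾ᶜ` (for `Λ₇⁽ᵏ⁾ᶜ`: `t′ = 7(r(Lᵏε) + ML)` by (2.8)) satisfy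
`|V q k| ≤ ((σ+2τ)S351 + 4 + 2τ′)ᵈ · r(Lᵏε)ᵈ · Σ_{j≤k} nC j`. [cite: Balaban1982Higgs2, (3.52) p.594] -/
theorem collar_of_cover (P : Params) (ρ : Run) (X : CData ρ) {σ τ τ' : ℝ}
    (hL2 : 2 ≤ (P.L : ℝ)) (hR : 1 ≤ P.R) (hr : 0 ≤ P.r) (hε : 0 < ρ.ε) (hK1 : epsK P ρ ρ.K ≤ 1)
    (hσ : 0 ≤ σ) (hτ : 0 ≤ τ)
    (W : ρ.Seq → ℕ → Finset (Fin P.d → ℤ)) (C : ρ.Seq → ℕ → Finset ((Fin P.d → ℤ) × ℕ))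
    (t s t' : ρ.Seq → ℕ → ℕ) (V : ρ.Seq → ℕ → Finset (Fin P.d → ℤ))
    (h0 : ∀ q, W q 0 ⊆ cubes (C q 0))
    (hnew : ∀ q k, ∀ y ∈ W q (k + 1), y ∈ cubes (C q (k + 1)) ∨
      ∃ x ∈ W q k, ∃ z : Fin P.d → ℤ, (∀ i, z i - x i ≤ t q k ∧ x i - z i ≤ t q k) ∧ blk P.L z = y)
    (hside : ∀ q k, ∀ c ∈ C q k, c.2 ≤ s q k)
    (hs : ∀ q k, k < ρ.K → (s q k : ℝ) ≤ σ * rFn P.R P.r (epsK P ρ k))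
    (ht : ∀ q k, k < ρ.K → (t q k : ℝ) ≤ τ * rFn P.R P.r (epsK P ρ k))
    (ht' : ∀ q k, k < ρ.K → (t' q k : ℝ) ≤ τ' * rFn P.R P.r (epsK P ρ k))
    (hV : ∀ q k, ∀ y ∈ V q k, ∃ x ∈ W q k, ∀ i, y i - x i ≤ t' q k ∧ x i - y i ≤ t' q k)
    (hC : ∀ q k, k < ρ.K → (C q k).card ≤ X.nC k q) :
    ∀ q k, k < ρ.K → ((V q k).card : ℝ) ≤ ((σ + 2 * τ) * S351 (P.L : ℝ) P.r + 4 + 2 * τ') ^ P.d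
      * rFn P.R P.r (epsK P ρ k) ^ P.d * ∑ j ∈ range (k + 1), (X.nC j q : ℝ) := by
  intro q k hk
  have hLpos : 0 < P.L := by exact_mod_cast (show (0 : ℝ) < P.L by linarith)
  set A : ℝ := (σ + 2 * τ) * S351 (P.L : ℝ) P.r + 4 with hA
  set rk : ℝ := rFn P.R P.r (epsK P ρ k) with hrk
  have hcount := card_collar_le_cover hLpos (t q) (s q) (W q) (C q) (h0 q) (hnew q) (hside q) k (t' q k)
    (V q k) (hV q k)
  have hside_r : ∀ l ∈ range (k + 1), (sideB P.L (t q) (s q) l (k - l) : ℝ) ≤ A * rk := fun l hl =>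
    sideB_le_r P ρ hL2 hR hr hε hK1 hσ hτ (t q) (s q) (hs q) (ht q)
      (Nat.lt_succ_iff.mp (Finset.mem_range.mp hl)) hk
  have ht'k := ht' q k hk
  calc ((V q k).card : ℝ)
      ≤ ∑ l ∈ range (k + 1), ((C q l).card : ℝ) * ((sideB P.L (t q) (s q) l (k - l) : ℝ) + 2 * (t' q k : ℝ)) ^ P.d := by
        exact_mod_cast hcount
    _ ≤ ∑ l ∈ range (k + 1), (X.nC l q : ℝ) * ((A + 2 * τ') * rk) ^ P.d := by
        refine Finset.sum_le_sum fun l hl => ?_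
        have h1 : ((C q l).card : ℝ) ≤ (X.nC l q : ℝ) := by
          exact_mod_cast hC q l (lt_of_le_of_lt (Nat.lt_succ_iff.mp (Finset.mem_range.mp hl)) hk)
        have h3 : (sideB P.L (t q) (s q) l (k - l) : ℝ) + 2 * (t' q k : ℝ) ≤ (A + 2 * τ') * rk := by
          have := hside_r l hl
          nlinarith
        have h2 : ((sideB P.L (t q) (s q) l (k - l) : ℝ) + 2 * (t' q k : ℝ)) ^ P.d ≤ ((A + 2 * τ') * rk) ^ P.d :=
          pow_le_pow_left₀ (by positivity) h3 _
        exact mul_le_mul h1 h2 (by positivity) (Nat.cast_nonneg _)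
    _ = (A + 2 * τ') ^ P.d * rk ^ P.d * ∑ l ∈ range (k + 1), (X.nC l q : ℝ) := by
        rw [Finset.mul_sum]
        exact Finset.sum_congr rfl fun l _ => by rw [mul_pow]; ring

/-! ## §3. (3.42) END TO END for one run: Sect. 3.C reduced to its model's defining properties -/

/-- **(3.42) for one run, END TO END** — `B2.Ineq342With P ρ (C₇ + C₅ + 1/m)` from: the (3.46) shape; lattice corridor
data per admissible sequence with the two cover properties and the printed-shape sizes (cube sides `≤ σr`, corridor
`≤ τr`); collar sets within `τ₇r`, `τ₅r` of `Λ₀⁽ᵏ⁾ᶜ` carrying the `Λ₇`/`Λ₅` volumes of (3.42); the k = K volumes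
`≤ |T₁⁽ᴷ⁾| ≤ |T_ε|`; the large-block structure of the sequences (`B2Ineq347SeqCount.entropy_of_blocks`); and the per-scale
(3.54) condition with `O(1) = (a₆ + θ + C₇ + C₅)(D + D₇ + D₅)/(R log L)`, `D = (A)ᵈ`, `D₇ = (A + 2τ₇)ᵈ`, `D₅ = (A + 2τ₅)ᵈ`,
`A = (σ + 2τ)S351 + 4`.  No typed leaf of §3.C is used. [cite: Balaban1982Higgs2, (3.42) p.592, Sect. 3.C pp.592–594] -/
theorem ineq342_of_cover (P : Params) (ρ : Run) (X : CData ρ) {a₆ θ m σ τ τ₇ τ₅ : ℝ}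
    (B : Fin ρ.K → Type*) [∀ k, Fintype (B k)] [∀ k, DecidableEq (B k)]
    (ι : ρ.Seq → ∀ k : Fin ρ.K, Finset (B k)) (hι : Function.Injective ι)
    (hL2 : 2 ≤ (P.L : ℝ)) (hR : 1 ≤ P.R) (hr : 2 ≤ P.r) (hε : 0 < ρ.ε) (hK1 : epsK P ρ ρ.K ≤ 1) (hκ : 0 ≤ P.κ₀)
    (hC₇ : 0 ≤ ρ.C₇) (hC₅ : 0 ≤ ρ.C₅) (ha₆ : 0 ≤ a₆) (hθ : 0 ≤ θ) (hσ : 0 ≤ σ) (hτ : 0 ≤ τ) (hτ₇ : 0 ≤ τ₇)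
    (hτ₅ : 0 ≤ τ₅) (hm : 0 < m) (hθm : (P.d : ℝ) + 1 ≤ θ * m) (hT : X.volTK ≤ ρ.volT)
    -- the (3.46) shape
    (hz : ∀ q k, k < ρ.K → 0 ≤ ρ.zeta k q)
    (h346 : ∀ q k, k < ρ.K → ρ.zeta k q ≤ Real.exp (a₆ * (X.vol0c k q : ℝ)) *
        Real.exp (-(c0 P.a P.γ₀ P.d * pFn P.b₀ P.p (epsK P ρ k) ^ 2 * (X.nC k q : ℝ))))
    -- the lattice corridor data
    (W : ρ.Seq → ℕ → Finset (Fin P.d → ℤ)) (C : ρ.Seq → ℕ → Finset ((Fin P.d → ℤ) × ℕ))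
    (t s t₇ t₅ : ρ.Seq → ℕ → ℕ) (V₇ V₅ : ρ.Seq → ℕ → Finset (Fin P.d → ℤ))
    (h0 : ∀ q, W q 0 ⊆ cubes (C q 0))
    (hnew : ∀ q k, ∀ y ∈ W q (k + 1), y ∈ cubes (C q (k + 1)) ∨
      ∃ x ∈ W q k, ∃ z : Fin P.d → ℤ, (∀ i, z i - x i ≤ t q k ∧ x i - z i ≤ t q k) ∧ blk P.L z = y)
    (hside : ∀ q k, ∀ c ∈ C q k, c.2 ≤ s q k)
    (hs : ∀ q k, k < ρ.K → (s q k : ℝ) ≤ σ * rFn P.R P.r (epsK P ρ k))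
    (ht : ∀ q k, k < ρ.K → (t q k : ℝ) ≤ τ * rFn P.R P.r (epsK P ρ k))
    (ht₇ : ∀ q k, k < ρ.K → (t₇ q k : ℝ) ≤ τ₇ * rFn P.R P.r (epsK P ρ k))
    (ht₅ : ∀ q k, k < ρ.K → (t₅ q k : ℝ) ≤ τ₅ * rFn P.R P.r (epsK P ρ k))
    (hV₇ : ∀ q k, ∀ y ∈ V₇ q k, ∃ x ∈ W q k, ∀ i, y i - x i ≤ t₇ q k ∧ x i - y i ≤ t₇ q k)
    (hV₅ : ∀ q k, ∀ y ∈ V₅ q k, ∃ x ∈ W q k, ∀ i, y i - x i ≤ t₅ q k ∧ x i - y i ≤ t₅ q k)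
    (hW : ∀ q k, k < ρ.K → X.vol0c k q ≤ (W q k).card)
    (hCn : ∀ q k, k < ρ.K → (C q k).card ≤ X.nC k q)
    (h7 : ∀ q k, k < ρ.K → ρ.vol7 k q ≤ (V₇ q k).card) (h5 : ∀ q k, k < ρ.K → ρ.vol5 k q ≤ (V₅ q k).card)
    (h7K : ∀ q, ρ.vol7 ρ.K q ≤ X.volTK) (h5K : ∀ q, ρ.vol5 ρ.K q ≤ X.volTK)
    -- the large-block structure of the sequences
    (hv : ∀ q (k : Fin ρ.K), m * ((ι q k).card : ℝ) ≤ (X.vol0c k q : ℝ))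
    (hN : ∀ k : Fin ρ.K,
      (Fintype.card (B k) : ℝ) * m * epsK P ρ k ^ P.d ≤ (X.volTK : ℝ) * epsK P ρ ρ.K ^ P.d)
    -- the per-scale condition of (3.54)
    (hcond : ∀ k, k < ρ.K →
        (a₆ + θ + ρ.C₇ + ρ.C₅) * (((σ + 2 * τ) * S351 (P.L : ℝ) P.r + 4) ^ P.d
            + ((σ + 2 * τ) * S351 (P.L : ℝ) P.r + 4 + 2 * τ₇) ^ P.d
            + ((σ + 2 * τ) * S351 (P.L : ℝ) P.r + 4 + 2 * τ₅) ^ P.d)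
          / (P.R * Real.log (P.L : ℝ)) * P.R ^ (P.d + 1)
          ≤ c0 P.a P.γ₀ P.d * P.b₀ ^ 2 * xk P ρ k ^ (2 * P.p - ((P.d : ℝ) + 1) * P.r)) :
    Ineq342With P ρ (ρ.C₇ + ρ.C₅ + 1 / m) := by
  have hL1 : 1 < (P.L : ℝ) := by linarith
  have hr0 : 0 ≤ P.r := by linarith
  have hR0 : 0 < P.R := by linarith
  have hS0 : 0 ≤ S351 (P.L : ℝ) P.r := le_trans zero_le_one (one_le_S351 (r := P.r) hL1)
  have hA0 : 0 ≤ (σ + 2 * τ) * S351 (P.L : ℝ) P.r + 4 := by positivity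
  have h352 := bound352_of_cover P ρ X hL2 hR hr0 hε hK1 hσ hτ W C t s h0 hnew hside hs ht hW hCn
  have hc7 := collar_of_cover P ρ X hL2 hR hr0 hε hK1 hσ hτ W C t s t₇ V₇ h0 hnew hside hs ht ht₇ hV₇ hCn
  have hc5 := collar_of_cover P ρ X hL2 hR hr0 hε hK1 hσ hτ W C t s t₅ V₅ h0 hnew hside hs ht ht₅ hV₅ hCn
  refine B2Ineq342From346.ineq342_of_346_blocks P ρ X B ι hι hL2 hR0 hr hε hK1 hκ hC₇ hC₅ ha₆ hθ
    (pow_nonneg hA0 _) (by positivity) (by positivity) hm hθm hT hz h346 h352 ?_ ?_ h7K h5K hv hN hcond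
  · intro q k hk
    exact le_trans (by exact_mod_cast h7 q k hk) (hc7 q k hk)
  · intro q k hk
    exact le_trans (by exact_mod_cast h5 q k hk) (hc5 q k hk)

end Literature.MathematicalPhysics.QuantumFieldTheory.Balaban1983to89.B2Ineq352CorridorBound
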